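import Summits.Schanuel.Schanuel.Theorems.SoloInformedAE1StructuredRoots
import Summits.Schanuel.Schanuel.Theorems.SoloInformedLemmaAE3
import Summits.Schanuel.Schanuel.Theorems.SoloInformedAPRigidity

/-!
# Theorem AE₃-1, first half: Roy's additive data force roots on an arithmetic progression

Soloist file (informed mode, seat `solo-Schanuel-informed`, s182).  The 3-term-progression
version of `SoloInformedAE1StructuredRoots` (Steps 0–3 of the seat's THEOREM AE₃-1,
`paper/AE-note.md` §14, `η = 0` form) on the node `RoyAdditiveDirichletExponent`
([cite: Roy2010, Thm 1.1]): a polynomial `P ∈ RoyAdditiveSmall ξ β σ τ ν n` (non-zero,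
`deg P ≤ n`, `H(P) ≤ exp(n^β)`, `|P(cξ)| ≤ exp(-n^ν)` for naturals `c ≤ n^σ`) together with
an integer `2000 ≤ K ≤ n^σ` and three explicit numerical inequalities (all eventually true when
`ν > 3 + β - 3σ`, `K = ⌊n^σ⌋`; that is the second half) yields a set `S' ⊆ [1, K]` of size
`≥ (49/100) K` and `γ, μ ∈ ℂ`, `μ ≠ 0`, such that every `γ + s μ` (`s ∈ S'`) is a ROOT of `P`
within `exp(-n^ν K / (80000 n))` of `s ξ`.

Chain: `soloSS_servedSet_int` with the finer serving parameter `t = 40000 n / K` (so that at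
most `K / 40000` points of `[1, K]` are unserved; `W = n^ν K / (80000 n)`) →
`soloAP_lemmaAE3` (LEMMA AE₃: the violated 3-term progressions `(x, m, z)` among served points
are inexact progressions of roots of defect `≤ 4 e^{-W}`, and
`#V₃ · log(1/(4ε)) ≤ 3 D² log M(P) + D³ log 4 ≤ 9 n² n^β`) →
`soloAR_even_affine_of_few_violated_progressions` (THEOREM C₃: `ρ (ι (2y)) = γ + y • μ` on a
set `Y` of `≥ 0.49 K` halves) → `μ ≠ 0` because two served roots near `aξ ≠ bξ` cannot
coincide.  The gain over AE-1 is the budget: `K²`-information against a `D² log M` price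
(`2.88·10¹¹ n³ n^β ≤ K³ n^ν`) instead of `K³` against `D³ log M` (`4·10⁷ n⁴ n^β ≤ K⁴ n^ν`).

Contents (prefix `soloS3_`): `soloS3_budget_le` (the right side of Lemma AE₃ is `≤ 9 n² n^β`)
and the main `soloS3_structured_roots`.

What this is NOT.  Not yet THEOREM AE₃-1 (the cheap dilated factor, Gel'fond's criterion and
the asymptotics are the second half), and nothing here bears on
`Literature.Periods.SchanuelConjecture` (the seat's verdict, no path, is unchanged); the node
itself [cite: Roy2010, Thm 1.1] is not claimed.  Tree files and Mathlib only; no definitions,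
no literature hypothesis; axioms the standard three.
-/

namespace Summit.Schanuel.Schanuel.Theorems

open Polynomial Finset

/-- The right side of Lemma AE₃ for `deg = D ≤ n`, `0 ≤ L ≤ 2 n^β`, `β ≥ 1`, `n ≥ 1`:
`3D² · L + D³ · log 4 ≤ 9 n² n^β`. -/
theorem soloS3_budget_le {D n : ℕ} (hDn : D ≤ n) (hn : 1 ≤ n) {β : ℝ} (hβ : 1 ≤ β) {L : ℝ}
    (hL0 : 0 ≤ L) (hL : L ≤ 2 * (n : ℝ) ^ β) :
    ((3 * D ^ 2 : ℕ) : ℝ) * L + ((D ^ 3 : ℕ) : ℝ) * Real.log 4 ≤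
      9 * ((n : ℝ) ^ 2 * (n : ℝ) ^ β) := by
  have hn1 : (1 : ℝ) ≤ n := by exact_mod_cast hn
  have hnβ : (n : ℝ) ≤ (n : ℝ) ^ β := by
    conv_lhs => rw [← Real.rpow_one (n : ℝ)]
    exact Real.rpow_le_rpow_of_exponent_le hn1 hβ
  have h1 : ((3 * D ^ 2 : ℕ) : ℝ) ≤ 3 * (n : ℝ) ^ 2 := by
    have h : 3 * D ^ 2 ≤ 3 * n ^ 2 := Nat.mul_le_mul_left 3 (Nat.pow_le_pow_left hDn 2)
    exact_mod_cast h
  have h2 : ((D ^ 3 : ℕ) : ℝ) ≤ (n : ℝ) ^ 3 := by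
    have h : D ^ 3 ≤ n ^ 3 := Nat.pow_le_pow_left hDn 3
    exact_mod_cast h
  have h3 : (n : ℝ) ^ 3 ≤ (n : ℝ) ^ 2 * (n : ℝ) ^ β := by
    rw [pow_succ]
    exact mul_le_mul_of_nonneg_left hnβ (by positivity)
  have hlog4 : Real.log 4 ≤ 3 := by
    have := Real.log_le_sub_one_of_pos (by norm_num : (0 : ℝ) < 4)
    linarith
  have hlog0 : 0 ≤ Real.log 4 := Real.log_nonneg (by norm_num)
  calc ((3 * D ^ 2 : ℕ) : ℝ) * L + ((D ^ 3 : ℕ) : ℝ) * Real.log 4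
      ≤ 3 * (n : ℝ) ^ 2 * (2 * (n : ℝ) ^ β) + (n : ℝ) ^ 3 * 3 :=
        add_le_add (mul_le_mul h1 hL hL0 (by positivity))
          (mul_le_mul h2 hlog4 hlog0 (by positivity))
    _ ≤ 9 * ((n : ℝ) ^ 2 * (n : ℝ) ^ β) := by nlinarith [h3]

/-- **Structured roots from Roy's additive data, 3-AP version (AE-note §14, `η = 0`).**
Let `P ∈ RoyAdditiveSmall ξ β σ τ ν n` (`β ≥ 1`, `n ≥ 1`), `2000 ≤ K ≤ n^σ`, `c₁` with
`exp(-c₁) ≤ min(1, ‖ξ‖/2)`, and put `W = n^ν K / (80000 n)`, `ε = exp(-W)`.  Assume the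
numerical inequalities `2 c₁ n ≤ n^ν`, `log 4 ≤ W/2` and `2.88·10¹¹ n³ n^β ≤ K³ n^ν`.  Then
there are `S' ⊆ [1, K]` with `#S' ≥ (49/100) K` and `γ, μ ∈ ℂ`, `μ ≠ 0`, such that for every
`s ∈ S'` the point `γ + s μ` is a root of `P` with `‖γ + s μ - s ξ‖ ≤ ε`. -/
theorem soloS3_structured_roots {ξ : ℂ} {β σ τ ν : ℝ} (hβ : 1 ≤ β) {n K : ℕ} (hn : 1 ≤ n)
    (hK : 2000 ≤ K) (hKσ : (K : ℝ) ≤ (n : ℝ) ^ σ) {c₁ : ℝ}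
    (hc : Real.exp (-c₁) ≤ min 1 (‖ξ‖ / 2)) (h₁ : 2 * c₁ * n ≤ (n : ℝ) ^ ν)
    (h₄ : Real.log 4 ≤ (n : ℝ) ^ ν * K / (160000 * n))
    (h₅ : 288000000000 * ((n : ℝ) ^ 3 * (n : ℝ) ^ β) ≤ (K : ℝ) ^ 3 * (n : ℝ) ^ ν)
    {P : ℤ[X]} (hP : P ∈ RoyAdditiveSmall ξ β σ τ ν n) :
    ∃ S' : Finset ℕ, S' ⊆ Icc 1 K ∧ (49 : ℝ) / 100 * K ≤ #S' ∧ ∃ γ μ : ℂ, μ ≠ 0 ∧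
      ∀ s ∈ S', aeval (γ + (s : ℂ) * μ) P = 0 ∧
        ‖(γ + (s : ℂ) * μ) - (s : ℂ) * ξ‖ ≤ Real.exp (-((n : ℝ) ^ ν * K / (80000 * n))) := by
  classical
  have hD0 : 0 < P.natDegree := soloSR_natDegree_pos hn hP
  obtain ⟨hP0, hdeg, hht, hsmall⟩ := hP
  obtain ⟨ρ, hρ⟩ := soloSI_exists_roots_enum (L := ℂ) P
  have hn0 : (0 : ℝ) < n := by exact_mod_cast hn
  have hK0 : (0 : ℝ) < K := by exact_mod_cast (show 0 < K by omega)
  have hV0 : 0 < (n : ℝ) ^ ν := Real.rpow_pos_of_pos hn0 ν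
  set W : ℝ := (n : ℝ) ^ ν * K / (80000 * n) with hW
  have hW0 : 0 < W := by positivity
  have hW2 : (n : ℝ) ^ ν * K / (160000 * n) = W / 2 := by rw [hW]; ring
  rw [hW2] at h₄
  set ε : ℝ := Real.exp (-W) with hε
  have hε0 : 0 < ε := Real.exp_pos _
  -- Step 1: the served set (serving parameter `t = 40000 n / K`)
  have hc₁0 : 0 ≤ c₁ := by
    have h := (le_min_iff.mp hc).1
    have := Real.exp_le_one_iff.mp h
    linarith
  have hVc : c₁ * n < (n : ℝ) ^ ν := by
    rcases (mul_nonneg hc₁0 hn0.le).eq_or_lt with h | h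
    · rw [← h]; exact hV0
    · linarith
  have hsmall' : ∀ c ∈ Icc 1 K,
      ‖(P.map (Int.castRingHom ℂ)).eval ((c : ℂ) * ξ + 0)‖ ≤ Real.exp (-(n : ℝ) ^ ν) := by
    intro c hc'
    have hcK : c ≤ K := (Finset.mem_Icc.mp hc').2
    have hi : (c : ℝ) ≤ (n : ℝ) ^ σ := le_trans (by exact_mod_cast hcK) hKσ
    have hj : ((0 : ℕ) : ℝ) ≤ (n : ℝ) ^ τ := by
      rw [Nat.cast_zero]; exact Real.rpow_nonneg hn0.le τ
    have h := hsmall c 0 hi hj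
    rw [hasseDeriv_zero'] at h
    rwa [add_zero, eval_map_intCastRingHom]
  obtain ⟨S, hSC, ι, hcardt, hι, hnear, hfar⟩ :=
    soloSS_servedSet_int (N := n) P hP0 ρ hρ hD0 hdeg ξ 0 (Icc 1 K) (40000 * n / K) hc hVc
      hsmall'
  have hrad : Real.exp (-((n : ℝ) ^ ν - c₁ * n) / (40000 * n / K)) ≤ ε := by
    rw [hε, Real.exp_le_exp, neg_div, neg_le_neg_iff, le_div_iff₀ (by positivity)]
    have : W * (40000 * n / K) = (n : ℝ) ^ ν / 2 := by
      rw [hW]; field_simp; ring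
    rw [this]
    linarith
  have hservedε : ∀ s ∈ S, ‖ρ (ι s) - (s * ξ + 0)‖ ≤ ε := fun s hs => (hfar s hs).trans hrad
  have hE : 40000 * #(Icc 1 K \ S) ≤ K := by
    have h : (#(Icc 1 K \ S) : ℝ) * (40000 * n / K) ≤ n := hcardt
    rw [← mul_div_assoc, div_le_iff₀ hK0] at h
    have h3 : (40000 * (#(Icc 1 K \ S) : ℝ)) * n ≤ K * n := by linarith
    have h4 := le_of_mul_le_mul_right h3 hn0
    exact_mod_cast h4
  -- Step 2: the violated 3-term progressions are inexact progressions of roots (Lemma AE₃)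
  set V₃ : Finset (ℕ × ℕ × ℕ) := (S ×ˢ (S ×ˢ S)).filter
    (fun c => c.1 + c.2.2 = 2 * c.2.1 ∧ ρ (ι c.1) + ρ (ι c.2.2) ≠ 2 * ρ (ι c.2.1)) with hV₃
  have hVmem : ∀ x ∈ S, ∀ m ∈ S, ∀ z ∈ S, x + z = 2 * m →
      (fun s => ρ (ι s)) x + (fun s => ρ (ι s)) z ≠ 2 • (fun s => ρ (ι s)) m →
        (x, m, z) ∈ V₃ := by
    intro x hx m hm z hz hxz hne
    rw [hV₃, Finset.mem_filter, Finset.mem_product, Finset.mem_product]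
    refine ⟨⟨hx, hm, hz⟩, hxz, ?_⟩
    intro h
    apply hne
    simp only [nsmul_eq_mul, Nat.cast_ofNat]
    exact h
  have hV₃mem : ∀ c ∈ V₃, (c.1 ∈ S ∧ c.2.1 ∈ S ∧ c.2.2 ∈ S) ∧ c.1 + c.2.2 = 2 * c.2.1 ∧
      ρ (ι c.1) + ρ (ι c.2.2) ≠ 2 * ρ (ι c.2.1) := by
    intro c hc
    rw [hV₃, Finset.mem_filter, Finset.mem_product, Finset.mem_product] at hc
    exact hc
  have hAE := soloAP_lemmaAE3 P hP0 rfl ρ hρ ξ 0 hε0 S ι hι hservedε V₃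
    (fun c hc => (hV₃mem c hc).1) (fun c hc => (hV₃mem c hc).2.1)
    (fun c hc => (hV₃mem c hc).2.2)
  -- the numerical budget: `#V₃ · W/2 ≤ 9 n² n^β`
  have hL : W / 2 ≤ Real.log (1 / (4 * ε)) := by
    rw [one_div, Real.log_inv, hε, Real.log_mul (by norm_num) (Real.exp_pos _).ne',
      Real.log_exp]
    linarith
  obtain ⟨hlogM0, hlogM⟩ := soloSR_log_mahlerMeasure_le hP0 hn hdeg hβ hht
  have hB := soloS3_budget_le hdeg hn hβ hlogM0 hlogM
  have hVcard : (#V₃ : ℝ) * (W / 2) ≤ 9 * ((n : ℝ) ^ 2 * (n : ℝ) ^ β) := by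
    calc (#V₃ : ℝ) * (W / 2) ≤ #V₃ * Real.log (1 / (4 * ε)) :=
          mul_le_mul_of_nonneg_left hL (Nat.cast_nonneg _)
      _ ≤ _ := hAE
      _ ≤ 9 * ((n : ℝ) ^ 2 * (n : ℝ) ^ β) := hB
  have hEq : (K : ℝ) ^ 2 * (W / 2) = (K : ℝ) ^ 3 * (n : ℝ) ^ ν / (160000 * n) := by
    rw [hW]; field_simp; ring
  have h16 : (0 : ℝ) < 160000 * n := by positivity
  have hn3β : (0 : ℝ) ≤ (n : ℝ) ^ 3 * (n : ℝ) ^ β :=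
    mul_nonneg (pow_nonneg hn0.le 3) (Real.rpow_nonneg hn0.le β)
  have hVK : 200000 * #V₃ ≤ K ^ 2 := by
    have key : (200000 * #V₃ : ℝ) * (W / 2) ≤ (K : ℝ) ^ 2 * (W / 2) := by
      calc (200000 * #V₃ : ℝ) * (W / 2) = 200000 * ((#V₃ : ℝ) * (W / 2)) := by ring
        _ ≤ 200000 * (9 * ((n : ℝ) ^ 2 * (n : ℝ) ^ β)) :=
            mul_le_mul_of_nonneg_left hVcard (by norm_num)
        _ ≤ (K : ℝ) ^ 2 * (W / 2) := by
            rw [hEq, le_div_iff₀ h16,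
              show (200000 : ℝ) * (9 * ((n : ℝ) ^ 2 * (n : ℝ) ^ β)) * (160000 * n) =
                288000000000 * ((n : ℝ) ^ 3 * (n : ℝ) ^ β) by ring]
            linarith [h₅, hn3β]
    have h := le_of_mul_le_mul_right key (half_pos hW0)
    exact_mod_cast h
  -- Step 3: Theorem C₃ (even part)
  obtain ⟨γ, μ, Y, hYcard, hY⟩ :=
    soloAR_even_affine_of_few_violated_progressions hK hE (fun s => ρ (ι s)) hVmem hVK
  have hY' : ∀ y ∈ Y, 2 * y ∈ S ∧ ρ (ι (2 * y)) = γ + ((2 * y : ℕ) : ℂ) * (μ / 2) := by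
    intro y hy
    obtain ⟨hyS, h⟩ := hY y hy
    refine ⟨hyS, ?_⟩
    have h' : ρ (ι (2 * y)) = γ + (y : ℂ) * μ := by
      have h'' := h
      simp only [nsmul_eq_mul] at h''
      exact h''
    rw [h']
    push_cast
    ring
  -- Step 4: the structured set `S' = 2 • Y`
  set S' := Y.image (fun y => 2 * y) with hS'
  have hS'sub : S' ⊆ Icc 1 K := by
    intro s hs
    obtain ⟨y, hy, rfl⟩ := Finset.mem_image.mp hs
    exact hSC (hY' y hy).1
  have hS'card' : #S' = #Y :=
    Finset.card_image_of_injective _ (fun a b h => by simpa using h)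
  have hS'card : (49 : ℝ) / 100 * K ≤ #S' := by
    rw [hS'card']
    have h : ((49 * K : ℕ) : ℝ) ≤ ((100 * #Y : ℕ) : ℝ) := by exact_mod_cast hYcard
    push_cast at h
    linarith
  have hS'aff : ∀ s ∈ S', s ∈ S ∧ ρ (ι s) = γ + (s : ℂ) * (μ / 2) := by
    intro s hs
    obtain ⟨y, hy, rfl⟩ := Finset.mem_image.mp hs
    exact hY' y hy
  have hμ : μ / 2 ≠ 0 := by
    intro hμ
    have hK' : (2000 : ℝ) ≤ K := by exact_mod_cast hK
    have h980 : (980 : ℝ) ≤ #S' := by linarith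
    have hcard' : 1 < #S' := by
      have : (980 : ℕ) ≤ #S' := by exact_mod_cast h980
      omega
    obtain ⟨a, ha, b, hb, hab⟩ := Finset.one_lt_card.mp hcard'
    obtain ⟨haS, hφa⟩ := hS'aff a ha
    obtain ⟨hbS, hφb⟩ := hS'aff b hb
    rw [hμ, mul_zero, add_zero] at hφa hφb
    have h1 := hnear a haS
    have h2 := hnear b hbS
    rw [hφa, add_zero] at h1
    rw [hφb, add_zero] at h2
    have h3 : ‖(a : ℂ) * ξ - (b : ℂ) * ξ‖ < ‖ξ‖ := by
      calc ‖(a : ℂ) * ξ - (b : ℂ) * ξ‖ = ‖(γ - (b : ℂ) * ξ) - (γ - (a : ℂ) * ξ)‖ := by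
            congr 1; ring
        _ ≤ ‖γ - (b : ℂ) * ξ‖ + ‖γ - (a : ℂ) * ξ‖ := norm_sub_le _ _
        _ < ‖ξ‖ / 2 + ‖ξ‖ / 2 := add_lt_add h2 h1
        _ = ‖ξ‖ := by ring
    have h4 : ‖ξ‖ ≤ ‖(a : ℂ) * ξ - (b : ℂ) * ξ‖ := by
      rw [← sub_mul, norm_mul]
      have hab' : (1 : ℝ) ≤ ‖((a : ℂ) - (b : ℂ))‖ := by
        have : ((a : ℂ) - (b : ℂ)) = ((a - b : ℤ) : ℂ) := by push_cast; ring
        rw [this, Complex.norm_intCast]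
        have hne : (a : ℤ) - b ≠ 0 := by omega
        exact_mod_cast Int.one_le_abs hne
      exact le_mul_of_one_le_left (norm_nonneg _) hab'
    linarith
  refine ⟨S', hS'sub, hS'card, γ, μ / 2, hμ, ?_⟩
  intro s hs
  obtain ⟨hsS, hφs⟩ := hS'aff s hs
  refine ⟨?_, ?_⟩
  · rw [← hφs]; exact soloSR_aeval_enum_eq_zero P hP0 ρ hρ (ι s)
  · rw [← hφs]
    have h := hservedε s hsS
    rwa [add_zero] at h

end Summit.Schanuel.Schanuel.Theorems
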